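import Mathlib
import HarnessLib
import Summits.QuantumFields.YangMills.Theorems.ComplexCouplingChannelContinuumLegGivenGapAlternatingArraysDefs
import Summits.QuantumFields.YangMills.Theorems.ComplexCouplingChannelContinuumLegGivenGapProductToUniformDefs
import Summits.QuantumFields.YangMills.Theorems.ComplexCouplingChannelContinuumLegGivenGapProductToUniformOffsets
import Summits.QuantumFields.YangMills.Theorems.ComplexCouplingChannelContinuumLegGivenGapPtuGeometryBasics

/-!
# `ContinuumLegGivenGap` (stmt-QuantumFields-15828), line `alternating-curvature-arrays`: `stub_ptuGeometry`, helper G2 — COVERAGE `W ≥ 1`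

Support file for the registered piece `stub_ptuGeometry` (geometry of the Whitney system of
`Theorems/ComplexCouplingChannelContinuumLegGivenGapProductToUniformDefs.lean`): the global normaliser
`ptuW = near + out + ∑_levels ∑_idx φ*` is `≥ 1` at EVERY configuration `y ∈ (ℝ⁴)^p` (`p ≥ 2`, triadic `L ≥ 1`).

Case analysis on `y`: if some pair is within `3Ra/4` in sup norm then `near = 1`; if some coordinate is `≥ aL/4` then
`out = 1`; otherwise let `ρ` be the least pair sup-distance (so `27·3^{m₀} a < ρ < aL/2`) and choose the level `m` with
`3^m ≤ ρ/(9a) < 3^{m+1}` (§1 `ptu_level_choice`: `m ∈ ptuLevels`, pairs are `≥ 18` cell sides apart in some axis, the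
closest pair `< 54` cell sides apart in every axis); the pigeonhole of P3 (`offsets_good_offset`, period `cellSide m`,
step `d = ptuD m p`) gives an offset `v ∈ ptuOffsets` keeping every lattice coordinate `yᵢμ/a` at wall distance
`≥ d/2 ≥ 2 + d/4`, so the inner cut-offs of the home cells are all `1` at `y` (§2) and the home-cell assignment is an
index of `ptuIdx` (cells `≥ 16` apart, closest `≤ 56`, central half-box, cell box; §3).  Registered anchor:
`ptuGeom_coverage` (§4).  Pure arithmetic. [folklore]
-/

set_option autoImplicit false

noncomputable section

open scoped Classical

namespace Summit.QuantumFields.YangMills.Theorems.ContinuumLegGivenGap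

open scoped BigOperators
open Summit.QuantumFields.YangMills.Theorems.ContinuumLegGivenGap.AlternatingArrays

/-! ## §1 Level selection -/

/-- **Level selection.** For a separation `ρ` with `27·3^{m₀} a < ρ < aL/2` (triadic `L`) there is a Whitney level `m`
with `9a·3^m ≤ ρ < 27a·3^m`. [folklore] -/
theorem ptu_level_choice {a ρ : ℝ} (ha : 0 < a) {L p : ℕ} (hL : IsTriadic L)
    (hlo : 27 * 3 ^ ptuM0 p * a < ρ) (hhi : ρ < a * (L : ℝ) / 2) :
    ∃ m ∈ ptuLevels L p, 9 * a * 3 ^ m ≤ ρ ∧ ρ < 27 * a * 3 ^ m := by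
  have h30 : (0 : ℝ) < 3 ^ ptuM0 p := by positivity
  have hρ : 0 < ρ := by nlinarith
  set n : ℕ := ⌊ρ / (9 * a)⌋₊ with hn
  have hρ9 : 0 ≤ ρ / (9 * a) := by positivity
  have h1 : (n : ℝ) ≤ ρ / (9 * a) := Nat.floor_le hρ9
  have h2 : ρ / (9 * a) < n + 1 := Nat.lt_floor_add_one _
  rw [le_div_iff₀ (by positivity)] at h1
  rw [div_lt_iff₀ (by positivity)] at h2
  -- `n ≥ 3^(m₀+1)`
  have h3 : 3 ^ (ptuM0 p + 1) ≤ n := by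
    rw [hn]
    refine Nat.le_floor ?_
    push_cast
    rw [le_div_iff₀ (by positivity), pow_succ]
    nlinarith
  have hn0 : n ≠ 0 := by
    have : 0 < 3 ^ (ptuM0 p + 1) := by positivity
    omega
  refine ⟨Nat.log 3 n, ?_, ?_, ?_⟩
  · unfold ptuLevels
    rw [Finset.mem_filter, Finset.mem_range]
    obtain ⟨M, hM⟩ := hL
    constructor
    · rw [hM, Nat.log_pow (by norm_num)]
      refine Nat.log_lt_of_lt_pow hn0 ?_
      have hM' : ((2 * L + 1 : ℕ) : ℝ) = ((3 ^ M : ℕ) : ℝ) := by exact_mod_cast hM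
      push_cast at hM'
      have hL0 : (0 : ℝ) ≤ L := Nat.cast_nonneg _
      have : (n : ℝ) < 3 ^ M := by nlinarith
      exact_mod_cast this
    · have : ptuM0 p + 1 ≤ Nat.log 3 n := Nat.le_log_of_pow_le (by norm_num) h3
      omega
  · have h4 : 3 ^ Nat.log 3 n ≤ n := Nat.pow_log_le_self 3 hn0
    have h4' : (3 : ℝ) ^ Nat.log 3 n ≤ n := by exact_mod_cast h4
    nlinarith
  · have h5 : n + 1 ≤ 3 ^ (Nat.log 3 n + 1) := Nat.lt_pow_succ_log_self (by norm_num) n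
    have h5' : (n : ℝ) + 1 ≤ 3 ^ (Nat.log 3 n + 1) := by exact_mod_cast h5
    rw [pow_succ] at h5'
    nlinarith

/-! ## §2 The good offset and the deep-core bump -/

/-- **A good offset.** For `m ≥ m₀` some offset `v ∈ ptuOffsets m p` keeps every lattice coordinate `yᵢμ / a` at depth
`≥ d/2` inside its home cell of the grid `v + cellSide m · ℤ⁴` (P3 pigeonhole). [folklore] -/
theorem ptu_good_offset (a : ℝ) {m p : ℕ} (hm : ptuM0 p ≤ m) (y : Fin p → EuclideanSpace ℝ (Fin 4)) :
    ∃ v ∈ ptuOffsets m p, ∀ (i : Fin p) (μ : Fin 4),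
      (v μ : ℝ) + cellSide m * (⌊(y i μ / a - v μ) / cellSide m⌋ : ℝ) + (ptuD m p : ℝ) / 2 ≤ y i μ / a ∧
        y i μ / a ≤ (v μ : ℝ) + cellSide m * ((⌊(y i μ / a - v μ) / cellSide m⌋ : ℝ) + 1) - (ptuD m p : ℝ) / 2 := by
  have hd32 : (32 : ℝ) ≤ ptuD m p := by exact_mod_cast ptuD_ge hm
  have hd : (0 : ℝ) < ptuD m p := by linarith
  have hS : 0 < cellSide m := by unfold cellSide; positivity
  obtain ⟨j, hj⟩ := offsets_good_offset p (fun i μ => y i μ / a) (cellSide m) (ptuD m p) hd (ptuD_mul_le m p)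
  refine ⟨fun μ => ((j μ : ℕ) : ℤ) * (ptuD m p : ℤ), ?_, fun i μ => ?_⟩
  · unfold ptuOffsets
    exact Finset.mem_image_of_mem (fun j' : Fin 4 → Fin (2 * p + 1) => fun μ => ((j' μ : ℕ) : ℤ) * (ptuD m p : ℤ))
      (Finset.mem_univ j)
  · have hv : ((((j μ : ℕ) : ℤ) * (ptuD m p : ℤ) : ℤ) : ℝ) = ((j μ : ℕ) : ℝ) * (ptuD m p : ℝ) := by push_cast; ring
    have hw : ∀ n : ℤ, (ptuD m p : ℝ) / 2 ≤
        |y i μ / a - (((((j μ : ℕ) : ℤ) * (ptuD m p : ℤ) : ℤ) : ℝ) + (n : ℝ) * cellSide m)| := by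
      intro n
      rw [hv]
      exact hj i μ n
    exact offsets_depth_of_wallDist hS hw

/-- **Deep points make the tensor bump `1`.** If every lattice coordinate lies at depth `≥ d/2` in the cell `zᵢ`, then
`φ*_{m,v,z}(y) = 1` (`d/2 ≥ 2 + d/4` as `d ≥ 32`). [folklore] -/
theorem ptuPhiStar_eq_one {a : ℝ} (ha : 0 < a) {m p : ℕ} (hm : ptuM0 p ≤ m) {v : Fin 4 → ℤ}
    {z : Fin p → Fin 4 → ℤ} {y : Fin p → EuclideanSpace ℝ (Fin 4)}
    (h : ∀ (i : Fin p) (μ : Fin 4), (v μ : ℝ) + cellSide m * (z i μ : ℝ) + (ptuD m p : ℝ) / 2 ≤ y i μ / a ∧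
      y i μ / a ≤ (v μ : ℝ) + cellSide m * ((z i μ : ℝ) + 1) - (ptuD m p : ℝ) / 2) :
    ptuPhiStar a m p v z y = 1 := by
  have hd32 : (32 : ℝ) ≤ ptuD m p := by exact_mod_cast ptuD_ge hm
  unfold ptuPhiStar ptuChiFun ptuCut
  refine Finset.prod_eq_one fun i _ => Finset.prod_eq_one fun μ _ => ?_
  obtain ⟨h1, h2⟩ := h i μ
  rw [le_div_iff₀ ha] at h1
  rw [div_le_iff₀ ha] at h2
  have hk : 0 ≤ a * ((ptuD m p : ℝ) / 4 - 2) := mul_nonneg ha.le (by linarith)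
  exact ptuPlateau_eq_one (by positivity) (by nlinarith) (by nlinarith)

/-! ## §3 Cells of separated points -/

/-- **Cell indices versus distances.** For the home cells `z = ⌊(t - v)/S⌋`, `z' = ⌊(t' - v)/S⌋` of two reals:
`|t - t'| - S < S |z - z'| < |t - t'| + S`. [folklore] -/
theorem ptu_cellIdx_diff {S : ℝ} (hS : 0 < S) (v t t' : ℝ) :
    |t - t'| - S < S * |((⌊(t - v) / S⌋ : ℝ) - ⌊(t' - v) / S⌋)| ∧
      S * |((⌊(t - v) / S⌋ : ℝ) - ⌊(t' - v) / S⌋)| < |t - t'| + S := by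
  obtain ⟨h1, h2⟩ := offsets_cellIdx_mem hS v t
  obtain ⟨h3, h4⟩ := offsets_cellIdx_mem hS v t'
  set z : ℝ := (⌊(t - v) / S⌋ : ℝ)
  set z' : ℝ := (⌊(t' - v) / S⌋ : ℝ)
  have hA : |(t - t') - S * (z - z')| < S := by
    rw [abs_lt]
    constructor <;> nlinarith
  have e : S * |z - z'| = |S * (z - z')| := by rw [abs_mul, abs_of_pos hS]
  rw [e]
  constructor
  · have := abs_sub_abs_le_abs_sub (t - t') (S * (z - z'))
    linarith
  · have := abs_sub_abs_le_abs_sub (S * (z - z')) (t - t')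
    have h' : |S * (z - z') - (t - t')| < S := by rw [abs_sub_comm]; exact hA
    linarith

/-- **Cell box.** A cell in the central half-box of a grid with an admissible offset has its index in `ptuCellBox L`.
[folklore] -/
theorem ptu_mem_cellBox {L m p : ℕ} {v z : Fin 4 → ℤ} (hv : v ∈ ptuOffsets m p) (h : CellInHalfBox L m v z) :
    z ∈ ptuCellBox L := by
  unfold ptuCellBox
  rw [Fintype.mem_piFinset]
  intro μ
  rw [Finset.mem_Icc]
  obtain ⟨h1, h2⟩ := h μ
  obtain ⟨hv0, hvS⟩ := ptuOffsets_spec hv μ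
  have hd : (0 : ℝ) ≤ ptuD m p := Nat.cast_nonneg _
  have hS : (1 : ℝ) / 2 ≤ cellSide m := by
    unfold cellSide
    have := one_le_pow₀ (show (1 : ℝ) ≤ 3 by norm_num) (n := m)
    linarith
  have hS0 : (0 : ℝ) ≤ cellSide m := by linarith
  have hL : (0 : ℝ) ≤ L := Nat.cast_nonneg _
  have hLS : 0 ≤ (cellSide m - 1 / 2) * (L : ℝ) := mul_nonneg (by linarith) hL
  constructor
  · by_contra hc
    push Not at hc
    have hc' : (z μ : ℝ) ≤ -(4 * (L : ℝ) + 4) - 1 := by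
      have : z μ ≤ -(4 * (L : ℤ) + 4) - 1 := by omega
      exact_mod_cast this
    have k : cellSide m * (z μ : ℝ) ≤ cellSide m * (-(4 * (L : ℝ) + 4) - 1) := mul_le_mul_of_nonneg_left hc' hS0
    nlinarith
  · by_contra hc
    push Not at hc
    have hc' : 4 * (L : ℝ) + 4 + 1 ≤ (z μ : ℝ) := by
      have : 4 * (L : ℤ) + 4 + 1 ≤ z μ := by omega
      exact_mod_cast this
    have k : cellSide m * (4 * (L : ℝ) + 4 + 1) ≤ cellSide m * (z μ : ℝ) := mul_le_mul_of_nonneg_left hc' hS0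
    nlinarith

/-- **The far case.** If every pair is `> 3Ra/4` apart in some axis and every coordinate is `< aL/4`, some deep-core
tensor bump of the Whitney system equals `1` at `y`. [folklore] -/
theorem ptu_far_cover {a : ℝ} (ha : 0 < a) {L p : ℕ} (hL : IsTriadic L) (hp : 2 ≤ p)
    {y : Fin p → EuclideanSpace ℝ (Fin 4)}
    (hnear : ∀ i j : Fin p, i ≠ j → ∃ μ : Fin 4, 3 * ((ptuR p : ℝ) * a) / 4 < |y i μ - y j μ|)
    (hout : ∀ (i : Fin p) (μ : Fin 4), |y i μ| < a * (L : ℝ) / 4) :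
    ∃ m ∈ ptuLevels L p, ∃ vz ∈ ptuIdx L m p, ptuPhiStar a m p vz.1 vz.2 y = 1 := by
  -- sup distance of a pair, the closest pair
  have hne4 : (Finset.univ : Finset (Fin 4)).Nonempty := ⟨0, Finset.mem_univ _⟩
  set D : Fin p × Fin p → ℝ := fun ij => Finset.univ.sup' hne4 fun μ : Fin 4 => |y ij.1 μ - y ij.2 μ| with hD
  have hDle : ∀ (ij : Fin p × Fin p) (μ : Fin 4), |y ij.1 μ - y ij.2 μ| ≤ D ij := fun ij μ =>
    Finset.le_sup' (fun μ : Fin 4 => |y ij.1 μ - y ij.2 μ|) (Finset.mem_univ μ)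
  have hDex : ∀ ij : Fin p × Fin p, ∃ μ : Fin 4, D ij = |y ij.1 μ - y ij.2 μ| := fun ij => by
    obtain ⟨μ, -, h⟩ := Finset.exists_mem_eq_sup' hne4 (fun μ : Fin 4 => |y ij.1 μ - y ij.2 μ|)
    exact ⟨μ, h⟩
  set P : Finset (Fin p × Fin p) := Finset.univ.filter fun ij => ij.1 ≠ ij.2 with hP
  have hPne : P.Nonempty := by
    refine ⟨(⟨0, by omega⟩, ⟨1, by omega⟩), Finset.mem_filter.2 ⟨Finset.mem_univ _, ?_⟩⟩
    intro h
    have := congrArg Fin.val h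
    simp at this
  obtain ⟨ij₀, hij₀P, hmin⟩ := Finset.exists_min_image P D hPne
  have hi₀ : ij₀.1 ≠ ij₀.2 := (Finset.mem_filter.1 hij₀P).2
  -- the separation `ρ = D ij₀` lies in `(27·3^{m₀} a, aL/2)`
  have hρlo : 27 * 3 ^ ptuM0 p * a < D ij₀ := by
    obtain ⟨μ, hμ⟩ := hnear _ _ hi₀
    have := hDle ij₀ μ
    unfold ptuR at hμ
    push_cast at hμ
    linarith
  have hρhi : D ij₀ < a * (L : ℝ) / 2 := by
    obtain ⟨μ, hμ⟩ := hDex ij₀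
    rw [hμ]
    have h1 := hout ij₀.1 μ
    have h2 := hout ij₀.2 μ
    calc |y ij₀.1 μ - y ij₀.2 μ| ≤ |y ij₀.1 μ| + |y ij₀.2 μ| := abs_sub _ _
      _ < a * (L : ℝ) / 2 := by linarith
  -- the level
  obtain ⟨m, hm, hm1, hm2⟩ := ptu_level_choice ha hL hρlo hρhi
  have hm0 : ptuM0 p ≤ m := by
    unfold ptuLevels at hm
    exact (Finset.mem_filter.1 hm).2
  have hS : 0 < cellSide m := by unfold cellSide; positivity
  have h3m : (3 : ℝ) ^ m = 2 * cellSide m := by unfold cellSide; ring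
  -- the offset and the home cells
  obtain ⟨v, hv, hdepth⟩ := ptu_good_offset a hm0 y
  set z : Fin p → Fin 4 → ℤ := fun i μ => ⌊(y i μ / a - v μ) / cellSide m⌋ with hz
  refine ⟨m, hm, (v, z), ?_, ptuPhiStar_eq_one ha hm0 hdepth⟩
  -- every home cell lies in the central half-box
  have hcell : ∀ i : Fin p, CellInHalfBox L m v (z i) := fun i =>
    offsets_cellInHalfBox_of_abs_le a L m v (y i) fun μ => by
      have h1 : |y i μ / a| < (L : ℝ) / 4 := by
        rw [abs_div, abs_of_pos ha, div_lt_iff₀ ha]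
        have := hout i μ
        linarith
      have h2 : (3 : ℝ) ^ m < (L : ℝ) / 18 := by
        by_contra hc
        push Not at hc
        nlinarith
      linarith
  refine mem_ptuIdx_of hv (fun i => ptu_mem_cellBox hv (hcell i)) hcell ?_ ?_
  · -- all pairs of cells are `≥ 16` apart
    intro i j hij
    have hρij : D ij₀ ≤ D (i, j) := hmin (i, j) (Finset.mem_filter.2 ⟨Finset.mem_univ _, hij⟩)
    obtain ⟨μ, hμ⟩ := hDex (i, j)
    have ht : 18 * cellSide m ≤ |y i μ / a - y j μ / a| := by
      rw [← sub_div, abs_div, abs_of_pos ha, le_div_iff₀ ha]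
      have e : D (i, j) = |y i μ - y j μ| := hμ
      nlinarith
    have hb : |y i μ / a - y j μ / a| - cellSide m < cellSide m * |((z i μ : ℝ) - z j μ)| :=
      (ptu_cellIdx_diff hS (v μ) (y i μ / a) (y j μ / a)).1
    have h17 : (17 : ℝ) < |((z i μ : ℝ) - z j μ)| :=
      lt_of_mul_lt_mul_left (show cellSide m * 17 < cellSide m * |((z i μ : ℝ) - z j μ)| by linarith) hS.le
    calc (16 : ℝ) ≤ |((z i μ : ℝ) - z j μ)| := by linarith
      _ = ‖(z i - z j) μ‖ := by rw [Pi.sub_apply, Int.norm_eq_abs]; push_cast; rfl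
      _ ≤ ‖z i - z j‖ := norm_le_pi_norm _ μ
  · -- the closest pair of cells is `≤ 56` apart
    refine ⟨ij₀.1, ij₀.2, hi₀, ?_⟩
    rw [pi_norm_le_iff_of_nonneg (by norm_num)]
    intro μ
    rw [Pi.sub_apply, Int.norm_eq_abs]
    push_cast
    have ht : |y ij₀.1 μ / a - y ij₀.2 μ / a| < 54 * cellSide m := by
      rw [← sub_div, abs_div, abs_of_pos ha, div_lt_iff₀ ha]
      have := hDle ij₀ μ
      nlinarith
    have hb : cellSide m * |((z ij₀.1 μ : ℝ) - z ij₀.2 μ)| < |y ij₀.1 μ / a - y ij₀.2 μ / a| + cellSide m :=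
      (ptu_cellIdx_diff hS (v μ) (y ij₀.1 μ / a) (y ij₀.2 μ / a)).2
    have h55 : |((z ij₀.1 μ : ℝ) - z ij₀.2 μ)| < 55 :=
      lt_of_mul_lt_mul_left (show cellSide m * |((z ij₀.1 μ : ℝ) - z ij₀.2 μ)| < cellSide m * 55 by linarith) hS.le
    linarith

/-! ## §4 Coverage -/

/-- Lower bounds for the normaliser: `near + out ≤ W` and every indexed tensor bump is `≤ W` (all summands are
non-negative). [folklore] -/
theorem ptuW_lower (a : ℝ) (L p : ℕ) (y : Fin p → EuclideanSpace ℝ (Fin 4)) :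
    ptuNear a p y + ptuOut a L p y ≤ ptuW a L p y ∧
      ∀ m ∈ ptuLevels L p, ∀ vz ∈ ptuIdx L m p, ptuPhiStar a m p vz.1 vz.2 y ≤ ptuW a L p y := by
  have hN := (ptuNear_mem a p y).1
  have hO := (ptuOut_mem a L p y).1
  have hΦ : ∀ (m : ℕ) (vz : (Fin 4 → ℤ) × (Fin p → Fin 4 → ℤ)), 0 ≤ ptuPhiStar a m p vz.1 vz.2 y := fun m vz =>
    (ptuPhiStar_mem a m p vz.1 vz.2 y).1
  have hsum : 0 ≤ ∑ m ∈ ptuLevels L p, ∑ vz ∈ ptuIdx L m p, ptuPhiStar a m p vz.1 vz.2 y :=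
    Finset.sum_nonneg fun m _ => Finset.sum_nonneg fun vz _ => hΦ m vz
  unfold ptuW
  refine ⟨by linarith, fun m hm vz hvz => ?_⟩
  -- (the order lemmas are applied to an opaque summand: unfolding `ptuPhiStar` under unification is expensive)
  have key1 : ∀ F : (Fin 4 → ℤ) × (Fin p → Fin 4 → ℤ) → ℝ, (∀ x, 0 ≤ F x) → F vz ≤ ∑ x ∈ ptuIdx L m p, F x :=
    fun F hF => Finset.single_le_sum (fun x _ => hF x) hvz
  have key2 : ∀ F : ℕ → ℝ, (∀ x, 0 ≤ F x) → F m ≤ ∑ x ∈ ptuLevels L p, F x :=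
    fun F hF => Finset.single_le_sum (fun x _ => hF x) hm
  have h1 : ptuPhiStar a m p vz.1 vz.2 y ≤ ∑ vz' ∈ ptuIdx L m p, ptuPhiStar a m p vz'.1 vz'.2 y :=
    key1 (fun vz' => ptuPhiStar a m p vz'.1 vz'.2 y) fun vz' => hΦ m vz'
  have h2 : ∑ vz' ∈ ptuIdx L m p, ptuPhiStar a m p vz'.1 vz'.2 y ≤
      ∑ m' ∈ ptuLevels L p, ∑ vz' ∈ ptuIdx L m' p, ptuPhiStar a m' p vz'.1 vz'.2 y :=
    key2 (fun m' => ∑ vz' ∈ ptuIdx L m' p, ptuPhiStar a m' p vz'.1 vz'.2 y)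
      fun m' => Finset.sum_nonneg fun vz' _ => hΦ m' vz'
  linarith

/-- **Coverage** (registered anchor of this file): the global normaliser of the Whitney system is `≥ 1` everywhere
(`p ≥ 2`, triadic `L ≥ 1`, `a > 0`). [folklore] -/
theorem ptuGeom_coverage : ∀ (a : ℝ) (L p : ℕ), 0 < a → IsTriadic L → 1 ≤ L → 2 ≤ p →
    ∀ y : (Fin p → EuclideanSpace ℝ (Fin 4)), 1 ≤ ptuW a L p y := by
  intro a L p ha hL hL1 hp y
  obtain ⟨hNO, hfar⟩ := ptuW_lower a L p y
  have hN := (ptuNear_mem a p y).1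
  have hO := (ptuOut_mem a L p y).1
  by_cases hnear : ∃ i j : Fin p, i ≠ j ∧ ∀ μ : Fin 4, |y i μ - y j μ| ≤ 3 * ((ptuR p : ℝ) * a) / 4
  · obtain ⟨i, j, hij, h⟩ := hnear
    have h1 := ptuNear_eq_one ha hij h
    linarith
  by_cases hout : ∃ (i : Fin p) (μ : Fin 4), a * (L : ℝ) / 4 ≤ |y i μ|
  · obtain ⟨i, μ, h⟩ := hout
    have h1 : ptuOut a L p y = 1 := ptuOut_eq_one ha hL1 h
    linarith
  push Not at hnear hout
  have hnear' : ∀ i j : Fin p, i ≠ j → ∃ μ : Fin 4, 3 * ((ptuR p : ℝ) * a) / 4 < |y i μ - y j μ| :=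
    fun i j hij => hnear i j hij
  obtain ⟨m, hm, vz, hvz, h1⟩ := ptu_far_cover ha hL hp hnear' hout
  have h2 := hfar m hm vz hvz
  linarith

end Summit.QuantumFields.YangMills.Theorems.ContinuumLegGivenGap

end
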